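import Literature.Analysis.FluidPDE.NovackBallAvgBalance
import Literature.Analysis.FluidPDE.BallAverageLimits
import Literature.Analysis.FluidPDE.MollifiedLimits
import Literature.Analysis.FluidPDE.PassiveScalarProofs
import HarnessLib

/-!
# The limit `ℓ → 0` of Novack's scale-`ℓ` pairing — discharge of `novack2024_ballAvg_balance_tendsto`

Sorry-free proof `Torus.novack2024_ballAvg_balance_tendsto_holds` of the named fact
`Torus.novack2024_ballAvg_balance_tendsto` of `Literature.Analysis.FluidPDE.NovackBallAvgBalance`
(Novack 2024, §2 Step 1: "the left-hand side of (eq:main:balance) converges in the sense of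
distributions as `ℓ → 0` to the left-hand side of (eq:main:balance:thm)"): for a jointly
measurable `u ∈ L³((0,T) × T^d)`, `p ∈ L^{3/2}` and a test function `ψ` supported in
`(0,T) × T^d`, Novack's scale-`ℓ` pairing
`𝒩_ℓ(ψ) = 2∫∫⟪u,u^ℓ⟫∂ₜψ + 2∫∫⟪u,u^ℓ⟫⟪u,∇ψ⟫ + ∫∫⟪(|u|²u)^ℓ,∇ψ⟫ − ∫∫(|u|²)^ℓ⟪u,∇ψ⟫ + 2∫∫p⟪u^ℓ,∇ψ⟫ + 2∫∫p^ℓ⟪u,∇ψ⟫`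
tends, as `ℓ → 0⁺`, to `∫∫ (2|u|²∂ₜψ + 2|u|²⟪u,∇ψ⟫ + 4p⟪u,∇ψ⟫)`.

## Proof

The ball averages `f^ℓ = ⨍_{B_ℓ} f(· + y) dy` converge to `f` in `L^q((0,T) × T^d)` for
`f ∈ L^q`, `1 ≤ q < ∞` (`Torus.tendsto_eLpNorm_ballAverage_sub` of
`Literature.Analysis.FluidPDE.BallAverageLimits`: continuity of translation and Jensen), applied
to `u` (`q = 3`), `|u|²u` (`q = 1`), `|u|²` (`q = 3/2`) and `p` (`q = 3/2`); each of the six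
pairings is a weighted bilinear pairing of one convergent factor with a fixed factor in the
dual class (`⟪u^ℓ, ∂ₜψ u⟫`, `⟪u^ℓ, ⟪u,∇ψ⟫u⟫`, `⟪(|u|²u)^ℓ, ∇ψ⟫`, `(|u|²)^ℓ ⟪u,∇ψ⟫`,
`⟪u^ℓ, p∇ψ⟫`, `p^ℓ ⟪u,∇ψ⟫`; Hölder pairs `(3, 3/2)`, `(1, ∞)`, `(3/2, 3)`), so it converges by
the tree's `tendsto_setIntegral_mul_bilin` (`MollifiedLimits`, through
`Filter.tendsto_iff_seq_tendsto`); the limits are `∫∫|u|²∂ₜψ`, `∫∫|u|²⟪u,∇ψ⟫` (three times) and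
`∫∫p⟪u,∇ψ⟫` (twice), which add up to the stated integral. Iterated integrals are converted to
integrals over the product measure by Fubini throughout.

## References

* M. Novack, *Scaling laws and exact results in turbulence*, Nonlinearity 37 (2024) 095002,
  arXiv:2310.01375, §2 Step 1 (the limit `ℓ → 0`). [Novack2024]
* G. B. Folland, *Real Analysis*, 2nd ed. (1999), Thm. 8.14 (a). [Folland1999]
-/

noncomputable section

open MeasureTheory TopologicalSpace Set Function Filter Metric
open _root_.Topology
open scoped InnerProductSpace RealInnerProductSpace ENNReal NNReal

namespace Literature.Analysis.FluidPDE.Torus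

variable {d : Type*} [Fintype d]

/-! ## Generic: weighted pairings with one `L^p`-convergent factor, along a filter -/

section Generic

variable {X : Type*} [MeasurableSpace X] {μ : Measure X}
  {E₁ E₂ : Type*} [NormedAddCommGroup E₁] [NormedSpace ℝ E₁] [NormedAddCommGroup E₂] [NormedSpace ℝ E₂]

/-- **Weighted bilinear pairings pass to the limit in one factor, along a filter**: if
`A_i → A₀` in `L^p` along a countably generated filter, `B ∈ L^q` is fixed (`1/p + 1/q = 1`,
`1 ≤ q`), `β` is a bounded bilinear real form and `w` a bounded weight, then
`∫ w β(A_i, B) → ∫ w β(A₀, B)` (the tree's sequential `tendsto_setIntegral_mul_bilin`, through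
`Filter.tendsto_iff_seq_tendsto`). [folklore] -/
theorem tendsto_integral_mul_bilin_of_tendsto_eLpNorm {ι : Type*} {l : Filter ι} [l.IsCountablyGenerated]
    {p q : ℝ≥0∞} [ENNReal.HolderTriple p q 1] (hq : 1 ≤ q) (β : E₁ →L[ℝ] E₂ →L[ℝ] ℝ)
    {A : ι → X → E₁} {A₀ : X → E₁} {B : X → E₂} (hA : ∀ᶠ i in l, MemLp (A i) p μ)
    (hA₀ : MemLp A₀ p μ) (hB : MemLp B q μ) (hAt : Tendsto (fun i => eLpNorm (A i - A₀) p μ) l (𝓝 0))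
    {w : X → ℝ} {C : ℝ} (hw : AEStronglyMeasurable w μ) (hwC : ∀ᵐ x ∂μ, ‖w x‖ ≤ C) :
    Tendsto (fun i => ∫ x, w x * β (A i x) (B x) ∂μ) l (𝓝 (∫ x, w x * β (A₀ x) (B x) ∂μ)) := by
  rw [tendsto_iff_seq_tendsto]
  intro s hs
  obtain ⟨k, hk⟩ := eventually_atTop.1 (hs.eventually hA)
  rw [← tendsto_add_atTop_iff_nat k]
  have h := tendsto_setIntegral_mul_bilin (μ := μ) hq β (fun n => hk (n + k) (Nat.le_add_left k n))
    hA₀ (fun _ => hB) hB ((hAt.comp hs).comp (tendsto_add_atTop_nat k)) (by simp) hw hwC univ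
  simp only [Measure.restrict_univ] at h
  exact h

/-- The Hölder triple `(3, 3/2, 1)`. [folklore] -/
theorem holderTriple_three_threeHalves : ENNReal.HolderTriple 3 (3 / 2 : ℝ≥0∞) 1 := by
  refine ⟨?_⟩
  have h1 : (3 / 2 : ℝ≥0∞)⁻¹ = 2 * 3⁻¹ := by
    rw [div_eq_mul_inv, ENNReal.mul_inv (Or.inl (by norm_num)) (Or.inl (by norm_num)), inv_inv,
      mul_comm]
  rw [h1, inv_one]
  calc (3 : ℝ≥0∞)⁻¹ + 2 * 3⁻¹ = (1 + 2) * 3⁻¹ := by rw [add_mul, one_mul]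
    _ = 3 * 3⁻¹ := by norm_num
    _ = 1 := ENNReal.mul_inv_cancel (by norm_num) (by norm_num)

end Generic

/-! ## `L^p` packaging on `(0,T) × T^d` -/

section Packaging

variable {T : ℝ} {F : Type*} [NormedAddCommGroup F] {u : ℝ → UnitAddTorus d → F}

/-- From `∫⁻∫⁻ ‖u‖ₑ^q < ∞` (iterated) to `MemLp (uncurry u) q` on the product. [folklore] -/
theorem memLp_uncurry_of_lintegral {q : ℝ} (hq : 0 < q)
    (hu : AEStronglyMeasurable (uncurry u) ((volume.restrict (Ioo 0 T)).prod volume))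
    (huq : ∫⁻ t in Ioo 0 T, ∫⁻ x, ‖u t x‖ₑ ^ q < ∞) :
    MemLp (uncurry u) (ENNReal.ofReal q) ((volume.restrict (Ioo 0 T)).prod volume) := by
  refine ⟨hu, ?_⟩
  rw [← ENNReal.rpow_lt_top_iff_of_pos hq, ← lintegral_enorm_rpow_eq_eLpNorm_rpow hq,
    lintegral_prod _ (hu.enorm.pow_const q)]
  exact huq

/-- From `MemLp (uncurry u) q` on the product to `∫⁻∫⁻ ‖u‖ₑ^q < ∞` (iterated). [folklore] -/
theorem lintegral_lt_top_of_memLp_uncurry {q : ℝ} (hq : 0 < q)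
    (hu : MemLp (uncurry u) (ENNReal.ofReal q) ((volume.restrict (Ioo 0 T)).prod volume)) :
    ∫⁻ t in Ioo 0 T, ∫⁻ x, ‖u t x‖ₑ ^ q < ∞ := by
  have h := hu.2
  rw [← ENNReal.rpow_lt_top_iff_of_pos hq, ← lintegral_enorm_rpow_eq_eLpNorm_rpow hq,
    lintegral_prod _ (hu.1.enorm.pow_const q)] at h
  exact h

variable [NormedSpace ℝ F]

/-- Ball averages of an `L^q` field are in `L^q((0,T) × T^d)` (`q ≥ 1`, `ℓ > 0`). [folklore] -/
theorem memLp_uncurry_ballAvg [Nonempty d] {q : ℝ} (hq : 1 ≤ q)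
    (hu : MemLp (uncurry u) (ENNReal.ofReal q) ((volume.restrict (Ioo 0 T)).prod volume))
    {ℓ : ℝ} (hℓ : 0 < ℓ) :
    MemLp (uncurry fun t x => ballAvg (u t) ℓ x) (ENNReal.ofReal q)
      ((volume.restrict (Ioo 0 T)).prod volume) := by
  have hq0 : 0 < q := one_pos.trans_le hq
  refine ⟨aestronglyMeasurable_ballAverage hu.1 _, ?_⟩
  have h := hu.2
  rw [← ENNReal.rpow_lt_top_iff_of_pos hq0, ← lintegral_enorm_rpow_eq_eLpNorm_rpow hq0] at h ⊢
  exact (lintegral_ballAverage_rpow_le hq hu.1 hℓ).trans_lt h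

/-- Ball averages converge in `L^q((0,T) × T^d)` (`MemLp` form of
`tendsto_eLpNorm_ballAverage_sub`). [folklore] -/
theorem tendsto_eLpNorm_ballAvg_sub [CompleteSpace F] [Nonempty d] {q : ℝ} (hq : 1 ≤ q)
    (hu : MemLp (uncurry u) (ENNReal.ofReal q) ((volume.restrict (Ioo 0 T)).prod volume)) :
    Tendsto (fun ℓ : ℝ => eLpNorm ((uncurry fun t x => ballAvg (u t) ℓ x) - uncurry u)
        (ENNReal.ofReal q) ((volume.restrict (Ioo 0 T)).prod volume)) (𝓝[>] 0) (𝓝 0) := by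
  have hq0 : 0 < q := one_pos.trans_le hq
  have h := tendsto_eLpNorm_ballAverage_sub hq hu.1 (lintegral_lt_top_of_memLp_uncurry hq0 hu)
  refine h.congr fun ℓ => ?_
  rfl

end Packaging

/-! ## The discharge -/

section Discharge

/-- **Discharge of `novack2024_ballAvg_balance_tendsto`** (Novack 2024, §2 Step 1, the limit
`ℓ → 0` of the scale-`ℓ` balance): see the module docstring. [cite: Novack2024, Sect. 2 Step 1, limit ℓ → 0] -/
theorem novack2024_ballAvg_balance_tendsto_holds : novack2024_ballAvg_balance_tendsto (d := d) := by
  intro _ T u₀ u p hd hT hsol hC hu3 hp hu₀ ψ hψ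
  haveI : Nonempty d := Fintype.card_pos_iff.1 (by omega)
  haveI := holderTriple_three_threeHalves
  haveI : ENNReal.HolderTriple (3 / 2 : ℝ≥0∞) 3 1 :=
    ⟨by rw [add_comm]; exact holderTriple_three_threeHalves.inv_add_inv_eq_inv⟩
  set μp : Measure (ℝ × UnitAddTorus d) := (volume.restrict (Ioo 0 T)).prod volume with hμp
  haveI : IsFiniteMeasure μp := by rw [hμp]; infer_instance
  -- measurability of `u`, `p`
  have hum : AEStronglyMeasurable (uncurry u) μp := aestronglyMeasurable_uncurry_prod_of_stLift_Ioo hsol.1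
  have hpm : AEStronglyMeasurable (uncurry p) μp := by
    have h := FunctionSpaces.Torus.aestronglyMeasurable_uncurry_of_stLift_restrict hsol.2.2.1
    rwa [Measure.volume_eq_prod, ← Measure.prod_restrict, Measure.restrict_univ] at h
  -- exponents
  have e3 : ENNReal.ofReal 3 = 3 := by norm_num
  have e32 : ENNReal.ofReal (3 / 2) = 3 / 2 := by
    rw [ENNReal.ofReal_div_of_pos (by norm_num)]; norm_num
  have e1 : ENNReal.ofReal 1 = 1 := ENNReal.ofReal_one
  -- `u ∈ L³`, `p ∈ L^{3/2}` on the product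
  have hU3r : MemLp (uncurry u) (ENNReal.ofReal 3) μp := by
    refine memLp_uncurry_of_lintegral (by norm_num) hum ?_
    have h3 : ∀ x : ℝ≥0∞, x ^ (3 : ℝ) = x ^ (3 : ℕ) := fun x => by
      rw [← ENNReal.rpow_natCast]; norm_num
    simpa only [h3] using hu3
  have hU3 : MemLp (uncurry u) 3 μp := e3 ▸ hU3r
  have h32le3 : (3 / 2 : ℝ≥0∞) ≤ 3 := by
    rw [ENNReal.div_le_iff (by norm_num) (by norm_num)]; norm_num
  have hU32 : MemLp (uncurry u) (3 / 2) μp := hU3.mono_exponent h32le3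
  have hP32r : MemLp (uncurry p) (ENNReal.ofReal (3 / 2)) μp := memLp_uncurry_of_lintegral (by norm_num) hpm hp
  have hP32 : MemLp (uncurry p) (3 / 2) μp := e32 ▸ hP32r
  -- the cubic and quadratic fields
  set W : ℝ → UnitAddTorus d → EuclideanSpace ℝ d := fun t x => ‖u t x‖ ^ 2 • u t x with hW
  set S : ℝ → UnitAddTorus d → ℝ := fun t x => ‖u t x‖ ^ 2 with hS
  have hWm : AEStronglyMeasurable (uncurry W) μp := (hum.norm.pow 2).smul hum
  have hSm : AEStronglyMeasurable (uncurry S) μp := hum.norm.pow 2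
  have hW1r : MemLp (uncurry W) (ENNReal.ofReal 1) μp := by
    rw [e1, memLp_one_iff_integrable]
    have hint : Integrable (fun q => ‖uncurry u q‖ ^ (3 : ℝ)) μp := by
      simpa using hU3.integrable_norm_rpow (by norm_num) (by norm_num)
    refine hint.mono' hWm (ae_of_all _ fun q => ?_)
    have h3 : ‖uncurry u q‖ ^ (3 : ℝ) = ‖uncurry u q‖ ^ (3 : ℕ) := by
      rw [← Real.rpow_natCast]; norm_num
    simp only [hW, uncurry, norm_smul, norm_pow, norm_norm, h3] at *
    exact le_of_eq (by ring)
  have hS32r : MemLp (uncurry S) (ENNReal.ofReal (3 / 2)) μp := by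
    have h := hU3.norm_rpow_div (2 : ℝ≥0∞)
    have hexp : (3 : ℝ≥0∞) / 2 = ENNReal.ofReal (3 / 2) := by rw [e32]
    rw [hexp] at h
    refine h.ae_eq (ae_of_all _ fun q => ?_)
    simp [hS, uncurry]
  have hS32 : MemLp (uncurry S) (3 / 2) μp := e32 ▸ hS32r
  have hW1 : MemLp (uncurry W) 1 μp := e1 ▸ hW1r
  -- ball averages: membership and convergence
  have hUℓ : ∀ {ℓ : ℝ}, 0 < ℓ → MemLp (uncurry fun t x => ballAvg (u t) ℓ x) 3 μp :=
    fun hℓ => e3 ▸ memLp_uncurry_ballAvg (by norm_num) hU3r hℓ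
  have hPℓ : ∀ {ℓ : ℝ}, 0 < ℓ → MemLp (uncurry fun t x => ballAvg (p t) ℓ x) (3 / 2) μp :=
    fun hℓ => e32 ▸ memLp_uncurry_ballAvg (by norm_num) hP32r hℓ
  have hWℓ : ∀ {ℓ : ℝ}, 0 < ℓ → MemLp (uncurry fun t x => ballAvg (W t) ℓ x) 1 μp :=
    fun hℓ => e1 ▸ memLp_uncurry_ballAvg le_rfl hW1r hℓ
  have hSℓ : ∀ {ℓ : ℝ}, 0 < ℓ → MemLp (uncurry fun t x => ballAvg (S t) ℓ x) (3 / 2) μp :=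
    fun hℓ => e32 ▸ memLp_uncurry_ballAvg (by norm_num) hS32r hℓ
  have hUt : Tendsto (fun ℓ : ℝ => eLpNorm ((uncurry fun t x => ballAvg (u t) ℓ x) - uncurry u) 3 μp)
      (𝓝[>] 0) (𝓝 0) := e3 ▸ tendsto_eLpNorm_ballAvg_sub (by norm_num) hU3r
  have hPt : Tendsto (fun ℓ : ℝ => eLpNorm ((uncurry fun t x => ballAvg (p t) ℓ x) - uncurry p) (3 / 2) μp)
      (𝓝[>] 0) (𝓝 0) := e32 ▸ tendsto_eLpNorm_ballAvg_sub (by norm_num) hP32r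
  have hWt : Tendsto (fun ℓ : ℝ => eLpNorm ((uncurry fun t x => ballAvg (W t) ℓ x) - uncurry W) 1 μp)
      (𝓝[>] 0) (𝓝 0) := e1 ▸ tendsto_eLpNorm_ballAvg_sub le_rfl hW1r
  have hSt : Tendsto (fun ℓ : ℝ => eLpNorm ((uncurry fun t x => ballAvg (S t) ℓ x) - uncurry S) (3 / 2) μp)
      (𝓝[>] 0) (𝓝 0) := e32 ▸ tendsto_eLpNorm_ballAvg_sub (by norm_num) hS32r
  -- the test function: `∂ₜψ`, `∇ψ` continuous and bounded on `[0,T] × T^d`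
  have hψT : FunctionSpaces.Torus.IsSpaceTimeTest T ψ := hψ.1
  have hψtc : Continuous (uncurry (FunctionSpaces.Torus.timeDeriv ψ)) := hψT.continuous_uncurry_timeDeriv
  have hψgc : Continuous (uncurry fun t x => FunctionSpaces.Torus.gradient (ψ t) x) :=
    hψT.continuous_uncurry_gradient
  obtain ⟨Ct, hCt⟩ := exists_bound_of_continuous_uncurry hψtc 0 T
  obtain ⟨Cg, hCg⟩ := exists_bound_of_continuous_uncurry hψgc 0 T
  have hIoo : ∀ᵐ q ∂μp, q.1 ∈ Ioo 0 T :=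
    (Measure.quasiMeasurePreserving_fst (μ := volume.restrict (Ioo 0 T))
      (ν := (volume : Measure (UnitAddTorus d)))).ae (ae_restrict_mem measurableSet_Ioo)
  have hψtm : AEStronglyMeasurable (uncurry (FunctionSpaces.Torus.timeDeriv ψ)) μp :=
    hψtc.aestronglyMeasurable
  have hψgm : AEStronglyMeasurable (uncurry fun t x => FunctionSpaces.Torus.gradient (ψ t) x) μp :=
    hψgc.aestronglyMeasurable
  have hψtb : ∀ᵐ q ∂μp, ‖uncurry (FunctionSpaces.Torus.timeDeriv ψ) q‖ ≤ Ct := by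
    filter_upwards [hIoo] with q hq; exact hCt q.1 (Ioo_subset_Icc_self hq) q.2
  have hψgb : ∀ᵐ q ∂μp, ‖uncurry (fun t x => FunctionSpaces.Torus.gradient (ψ t) x) q‖ ≤ Cg := by
    filter_upwards [hIoo] with q hq; exact hCg q.1 (Ioo_subset_Icc_self hq) q.2
  have h1m : AEStronglyMeasurable (fun _ : ℝ × UnitAddTorus d => (1 : ℝ)) μp := aestronglyMeasurable_const
  have h1b : ∀ᵐ q ∂μp, ‖(fun _ : ℝ × UnitAddTorus d => (1 : ℝ)) q‖ ≤ 1 := ae_of_all _ fun _ => by simp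
  -- the inner product as a bounded bilinear form (real-linear in both slots)
  set βI : EuclideanSpace ℝ d →L[ℝ] EuclideanSpace ℝ d →L[ℝ] ℝ := innerSL ℝ with hβIdef
  have hβI : ∀ v w : EuclideanSpace ℝ d, βI v w = ⟪v, w⟫ := fun v w => rfl
  -- the fixed second factors
  set B₂ : ℝ × UnitAddTorus d → EuclideanSpace ℝ d :=
    fun q => (inner ℝ (uncurry u q) (FunctionSpaces.Torus.gradient (ψ q.1) q.2)) • uncurry u q with hB₂def
  set B₄ : ℝ × UnitAddTorus d → ℝ := fun q => inner ℝ (uncurry u q) (FunctionSpaces.Torus.gradient (ψ q.1) q.2) with hB₄def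
  set B₅ : ℝ × UnitAddTorus d → EuclideanSpace ℝ d := fun q => uncurry p q • FunctionSpaces.Torus.gradient (ψ q.1) q.2 with hB₅def
  have hB₄m : AEStronglyMeasurable B₄ μp := hum.inner hψgm
  have hB₄ : MemLp B₄ 3 μp := by
    refine MemLp.of_le_mul hU3 hB₄m (c := Cg) ?_
    filter_upwards [hψgb] with q hq
    rw [hB₄def, Real.norm_eq_abs]
    calc |⟪uncurry u q, FunctionSpaces.Torus.gradient (ψ q.1) q.2⟫|
        ≤ ‖uncurry u q‖ * ‖FunctionSpaces.Torus.gradient (ψ q.1) q.2‖ := abs_real_inner_le_norm _ _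
      _ ≤ ‖uncurry u q‖ * Cg := by gcongr; exact hq
      _ = Cg * ‖uncurry u q‖ := mul_comm _ _
  have hB₂ : MemLp B₂ (3 / 2) μp := by
    refine MemLp.of_le_mul hS32 (hB₄m.smul hum) (c := Cg) ?_
    filter_upwards [hψgb] with q hq
    rw [hB₂def, norm_smul, Real.norm_eq_abs, hS]
    simp only [uncurry, Real.norm_eq_abs, abs_pow, abs_norm]
    calc |⟪u q.1 q.2, FunctionSpaces.Torus.gradient (ψ q.1) q.2⟫| * ‖u q.1 q.2‖
        ≤ ‖u q.1 q.2‖ * Cg * ‖u q.1 q.2‖ := by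
          gcongr
          exact (abs_real_inner_le_norm _ _).trans (by gcongr; exact hq)
      _ = Cg * ‖u q.1 q.2‖ ^ 2 := by ring
  have hB₃ : MemLp (uncurry fun t x => FunctionSpaces.Torus.gradient (ψ t) x) ⊤ μp :=
    memLp_top_of_bound hψgm Cg hψgb
  have hB₅ : MemLp B₅ (3 / 2) μp := by
    refine MemLp.of_le_mul hP32 (hpm.smul hψgm) (c := Cg) ?_
    filter_upwards [hψgb] with q hq
    rw [hB₅def, norm_smul]
    calc ‖uncurry p q‖ * ‖FunctionSpaces.Torus.gradient (ψ q.1) q.2‖ ≤ ‖uncurry p q‖ * Cg := by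
          gcongr; exact hq
      _ = Cg * ‖uncurry p q‖ := mul_comm _ _
  -- eventual memberships of the moving factors
  have evU : ∀ᶠ ℓ in 𝓝[>] (0 : ℝ), MemLp (uncurry fun t x => ballAvg (u t) ℓ x) 3 μp :=
    eventually_mem_nhdsWithin.mono fun ℓ hℓ => hUℓ hℓ
  have evP : ∀ᶠ ℓ in 𝓝[>] (0 : ℝ), MemLp (uncurry fun t x => ballAvg (p t) ℓ x) (3 / 2) μp :=
    eventually_mem_nhdsWithin.mono fun ℓ hℓ => hPℓ hℓ
  have evW : ∀ᶠ ℓ in 𝓝[>] (0 : ℝ), MemLp (uncurry fun t x => ballAvg (W t) ℓ x) 1 μp :=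
    eventually_mem_nhdsWithin.mono fun ℓ hℓ => hWℓ hℓ
  have evS : ∀ᶠ ℓ in 𝓝[>] (0 : ℝ), MemLp (uncurry fun t x => ballAvg (S t) ℓ x) (3 / 2) μp :=
    eventually_mem_nhdsWithin.mono fun ℓ hℓ => hSℓ hℓ
  -- the six limits, in product form
  have T1 := tendsto_integral_mul_bilin_of_tendsto_eLpNorm (μ := μp) (p := 3) (q := 3 / 2)
    (by rw [ENNReal.le_div_iff_mul_le (by norm_num) (by norm_num)]; norm_num) βI
    evU hU3 hU32 hUt hψtm hψtb
  have T2 := tendsto_integral_mul_bilin_of_tendsto_eLpNorm (μ := μp) (p := 3) (q := 3 / 2)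
    (by rw [ENNReal.le_div_iff_mul_le (by norm_num) (by norm_num)]; norm_num) βI
    evU hU3 hB₂ hUt h1m h1b
  have T3 := tendsto_integral_mul_bilin_of_tendsto_eLpNorm (μ := μp) (p := 1) (q := ⊤) le_top
    βI evW hW1 hB₃ hWt h1m h1b
  have T4 := tendsto_integral_mul_bilin_of_tendsto_eLpNorm (μ := μp) (p := 3 / 2) (q := 3)
    (by norm_num) (ContinuousLinearMap.mul ℝ ℝ) evS hS32 hB₄ hSt h1m h1b
  have T5 := tendsto_integral_mul_bilin_of_tendsto_eLpNorm (μ := μp) (p := 3) (q := 3 / 2)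
    (by rw [ENNReal.le_div_iff_mul_le (by norm_num) (by norm_num)]; norm_num) βI
    evU hU3 hB₅ hUt h1m h1b
  have T6 := tendsto_integral_mul_bilin_of_tendsto_eLpNorm (μ := μp) (p := 3 / 2) (q := 3)
    (by norm_num) (ContinuousLinearMap.mul ℝ ℝ) evP hP32 hB₄ hPt h1m h1b
  -- iterated integrals of `novackBallPairing` in product form
  have conv1 : ∀ {ℓ : ℝ}, 0 < ℓ →
      ∫ t in Ioo 0 T, ∫ x, ⟪u t x, ballAvg (u t) ℓ x⟫ * FunctionSpaces.Torus.timeDeriv ψ t x =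
        ∫ q, uncurry (FunctionSpaces.Torus.timeDeriv ψ) q *
          βI ((uncurry fun t x => ballAvg (u t) ℓ x) q) (uncurry u q) ∂μp := by
    intro ℓ hℓ
    have hint := integrable_mul_bilin_of_memLp (μ := μp) βI (hUℓ hℓ) hU32 hψtm hψtb
    rw [integral_prod _ hint]
    refine integral_congr_ae (ae_of_all _ fun t => integral_congr_ae (ae_of_all _ fun x => ?_))
    simp only [uncurry, hβI]
    rw [real_inner_comm, mul_comm]
  have conv2 : ∀ {ℓ : ℝ}, 0 < ℓ →
      ∫ t in Ioo 0 T, ∫ x, ⟪u t x, ballAvg (u t) ℓ x⟫ * ⟪u t x, FunctionSpaces.Torus.gradient (ψ t) x⟫ =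
        ∫ q, (fun _ : ℝ × UnitAddTorus d => (1 : ℝ)) q *
          βI ((uncurry fun t x => ballAvg (u t) ℓ x) q) (B₂ q) ∂μp := by
    intro ℓ hℓ
    have hint := integrable_mul_bilin_of_memLp (μ := μp) βI (hUℓ hℓ) hB₂ h1m h1b
    rw [integral_prod _ hint]
    refine integral_congr_ae (ae_of_all _ fun t => integral_congr_ae (ae_of_all _ fun x => ?_))
    simp only [uncurry, hβI, hB₂def, one_mul, inner_smul_right]
    rw [real_inner_comm (u t x)]
    ring
  have conv3 : ∀ {ℓ : ℝ}, 0 < ℓ →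
      ∫ t in Ioo 0 T, ∫ x, ⟪ballAvg (fun y => ‖u t y‖ ^ 2 • u t y) ℓ x, FunctionSpaces.Torus.gradient (ψ t) x⟫ =
        ∫ q, (fun _ : ℝ × UnitAddTorus d => (1 : ℝ)) q *
          βI ((uncurry fun t x => ballAvg (W t) ℓ x) q)
            ((uncurry fun t x => FunctionSpaces.Torus.gradient (ψ t) x) q) ∂μp := by
    intro ℓ hℓ
    have hint := integrable_mul_bilin_of_memLp (μ := μp) βI (hWℓ hℓ) hB₃ h1m h1b
    rw [integral_prod _ hint]
    refine integral_congr_ae (ae_of_all _ fun t => integral_congr_ae (ae_of_all _ fun x => ?_))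
    simp only [uncurry, hβI, one_mul, hW]
  have conv4 : ∀ {ℓ : ℝ}, 0 < ℓ →
      ∫ t in Ioo 0 T, ∫ x, ballAvg (fun y => ‖u t y‖ ^ 2) ℓ x * ⟪u t x, FunctionSpaces.Torus.gradient (ψ t) x⟫ =
        ∫ q, (fun _ : ℝ × UnitAddTorus d => (1 : ℝ)) q *
          ContinuousLinearMap.mul ℝ ℝ ((uncurry fun t x => ballAvg (S t) ℓ x) q) (B₄ q) ∂μp := by
    intro ℓ hℓ
    have hint := integrable_mul_bilin_of_memLp (μ := μp) (ContinuousLinearMap.mul ℝ ℝ) (hSℓ hℓ) hB₄ h1m h1b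
    rw [integral_prod _ hint]
    refine integral_congr_ae (ae_of_all _ fun t => integral_congr_ae (ae_of_all _ fun x => ?_))
    simp only [uncurry, ContinuousLinearMap.mul_apply', one_mul, hS, hB₄def]
  have conv5 : ∀ {ℓ : ℝ}, 0 < ℓ →
      ∫ t in Ioo 0 T, ∫ x, p t x * ⟪ballAvg (u t) ℓ x, FunctionSpaces.Torus.gradient (ψ t) x⟫ =
        ∫ q, (fun _ : ℝ × UnitAddTorus d => (1 : ℝ)) q *
          βI ((uncurry fun t x => ballAvg (u t) ℓ x) q) (B₅ q) ∂μp := by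
    intro ℓ hℓ
    have hint := integrable_mul_bilin_of_memLp (μ := μp) βI (hUℓ hℓ) hB₅ h1m h1b
    rw [integral_prod _ hint]
    refine integral_congr_ae (ae_of_all _ fun t => integral_congr_ae (ae_of_all _ fun x => ?_))
    simp only [uncurry, hβI, hB₅def, one_mul, inner_smul_right]
  have conv6 : ∀ {ℓ : ℝ}, 0 < ℓ →
      ∫ t in Ioo 0 T, ∫ x, ballAvg (p t) ℓ x * ⟪u t x, FunctionSpaces.Torus.gradient (ψ t) x⟫ =
        ∫ q, (fun _ : ℝ × UnitAddTorus d => (1 : ℝ)) q *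
          ContinuousLinearMap.mul ℝ ℝ ((uncurry fun t x => ballAvg (p t) ℓ x) q) (B₄ q) ∂μp := by
    intro ℓ hℓ
    have hint := integrable_mul_bilin_of_memLp (μ := μp) (ContinuousLinearMap.mul ℝ ℝ) (hPℓ hℓ) hB₄ h1m h1b
    rw [integral_prod _ hint]
    refine integral_congr_ae (ae_of_all _ fun t => integral_congr_ae (ae_of_all _ fun x => ?_))
    simp only [uncurry, ContinuousLinearMap.mul_apply', one_mul, hB₄def]
  -- identification of the limits
  have hL32 : ∫ q, (fun _ : ℝ × UnitAddTorus d => (1 : ℝ)) q *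
        βI (uncurry W q) ((uncurry fun t x => FunctionSpaces.Torus.gradient (ψ t) x) q) ∂μp =
      ∫ q, (fun _ : ℝ × UnitAddTorus d => (1 : ℝ)) q * βI (uncurry u q) (B₂ q) ∂μp := by
    refine integral_congr_ae (ae_of_all _ fun q => ?_)
    simp only [uncurry, hβI, hW, hB₂def, one_mul, inner_smul_right, real_inner_smul_left,
      real_inner_self_eq_norm_sq]
    ring
  have hL42 : ∫ q, (fun _ : ℝ × UnitAddTorus d => (1 : ℝ)) q *
        ContinuousLinearMap.mul ℝ ℝ (uncurry S q) (B₄ q) ∂μp =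
      ∫ q, (fun _ : ℝ × UnitAddTorus d => (1 : ℝ)) q * βI (uncurry u q) (B₂ q) ∂μp := by
    refine integral_congr_ae (ae_of_all _ fun q => ?_)
    simp only [uncurry, hβI, ContinuousLinearMap.mul_apply', hS, hB₂def, hB₄def, one_mul,
      inner_smul_right, real_inner_self_eq_norm_sq]
    ring
  have hL65 : ∫ q, (fun _ : ℝ × UnitAddTorus d => (1 : ℝ)) q *
        ContinuousLinearMap.mul ℝ ℝ (uncurry p q) (B₄ q) ∂μp =
      ∫ q, (fun _ : ℝ × UnitAddTorus d => (1 : ℝ)) q * βI (uncurry u q) (B₅ q) ∂μp := by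
    refine integral_congr_ae (ae_of_all _ fun q => ?_)
    simp only [uncurry, hβI, ContinuousLinearMap.mul_apply', hB₄def, hB₅def, one_mul,
      inner_smul_right]
  -- the target in product form
  have hf1 := integrable_mul_bilin_of_memLp (μ := μp) βI hU3 hU32 hψtm hψtb
  have hf2 := integrable_mul_bilin_of_memLp (μ := μp) βI hU3 hB₂ h1m h1b
  have hf5 := integrable_mul_bilin_of_memLp (μ := μp) βI hU3 hB₅ h1m h1b
  have htarget : ∫ t in Ioo 0 T, ∫ x,
      (2 * (‖u t x‖ ^ 2 * FunctionSpaces.Torus.timeDeriv ψ t x) +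
        2 * (‖u t x‖ ^ 2 * ⟪u t x, FunctionSpaces.Torus.gradient (ψ t) x⟫) +
        4 * (p t x * ⟪u t x, FunctionSpaces.Torus.gradient (ψ t) x⟫)) =
      2 * (∫ q, uncurry (FunctionSpaces.Torus.timeDeriv ψ) q * βI (uncurry u q) (uncurry u q) ∂μp) +
      2 * (∫ q, (fun _ : ℝ × UnitAddTorus d => (1 : ℝ)) q * βI (uncurry u q) (B₂ q) ∂μp) +
      4 * (∫ q, (fun _ : ℝ × UnitAddTorus d => (1 : ℝ)) q * βI (uncurry u q) (B₅ q) ∂μp) := by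
    have hf1c : Integrable (fun q => 2 * (uncurry (FunctionSpaces.Torus.timeDeriv ψ) q *
        βI (uncurry u q) (uncurry u q))) μp := hf1.const_mul 2
    have hf2c : Integrable (fun q => 2 * ((fun _ : ℝ × UnitAddTorus d => (1 : ℝ)) q *
        βI (uncurry u q) (B₂ q))) μp := hf2.const_mul 2
    have hf5c : Integrable (fun q => 4 * ((fun _ : ℝ × UnitAddTorus d => (1 : ℝ)) q *
        βI (uncurry u q) (B₅ q))) μp := hf5.const_mul 4
    have h12 : Integrable (fun q => 2 * (uncurry (FunctionSpaces.Torus.timeDeriv ψ) q *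
        βI (uncurry u q) (uncurry u q)) +
        2 * ((fun _ : ℝ × UnitAddTorus d => (1 : ℝ)) q * βI (uncurry u q) (B₂ q))) μp := hf1c.add hf2c
    have hsum : Integrable (fun q => 2 * (uncurry (FunctionSpaces.Torus.timeDeriv ψ) q *
        βI (uncurry u q) (uncurry u q)) +
        2 * ((fun _ : ℝ × UnitAddTorus d => (1 : ℝ)) q * βI (uncurry u q) (B₂ q)) +
        4 * ((fun _ : ℝ × UnitAddTorus d => (1 : ℝ)) q * βI (uncurry u q) (B₅ q))) μp := h12.add hf5c
    have hrhs : 2 * (∫ q, uncurry (FunctionSpaces.Torus.timeDeriv ψ) q * βI (uncurry u q) (uncurry u q) ∂μp) +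
        2 * (∫ q, (fun _ : ℝ × UnitAddTorus d => (1 : ℝ)) q * βI (uncurry u q) (B₂ q) ∂μp) +
        4 * (∫ q, (fun _ : ℝ × UnitAddTorus d => (1 : ℝ)) q * βI (uncurry u q) (B₅ q) ∂μp) =
        ∫ q, (2 * (uncurry (FunctionSpaces.Torus.timeDeriv ψ) q * βI (uncurry u q) (uncurry u q)) +
          2 * ((fun _ : ℝ × UnitAddTorus d => (1 : ℝ)) q * βI (uncurry u q) (B₂ q)) +
          4 * ((fun _ : ℝ × UnitAddTorus d => (1 : ℝ)) q * βI (uncurry u q) (B₅ q))) ∂μp := by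
      rw [integral_add h12 hf5c, integral_add hf1c hf2c,
        integral_const_mul (2 : ℝ) (fun q => uncurry (FunctionSpaces.Torus.timeDeriv ψ) q *
          βI (uncurry u q) (uncurry u q)),
        integral_const_mul (2 : ℝ) (fun q => (fun _ : ℝ × UnitAddTorus d => (1 : ℝ)) q *
          βI (uncurry u q) (B₂ q)),
        integral_const_mul (4 : ℝ) (fun q => (fun _ : ℝ × UnitAddTorus d => (1 : ℝ)) q *
          βI (uncurry u q) (B₅ q))]
    rw [hrhs, integral_prod _ hsum]
    refine integral_congr_ae (ae_of_all _ fun t => integral_congr_ae (ae_of_all _ fun x => ?_))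
    simp only [uncurry, hβI, hB₂def, hB₅def, one_mul, inner_smul_right,
      real_inner_self_eq_norm_sq]
    ring
  -- assembly
  have hlim := (((((T1.const_mul 2).add (T2.const_mul 2)).add T3).sub T4).add (T5.const_mul 2)).add
    (T6.const_mul 2)
  rw [hL32, hL42, hL65] at hlim
  rw [htarget]
  have hval : ∀ a b c : ℝ, 2 * a + 2 * b + b - b + 2 * c + 2 * c = 2 * a + 2 * b + 4 * c := fun a b c => by ring
  rw [hval] at hlim
  refine hlim.congr' ?_
  filter_upwards [eventually_mem_nhdsWithin] with ℓ hℓ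
  rw [novackBallPairing, conv1 hℓ, conv2 hℓ, conv3 hℓ, conv4 hℓ, conv5 hℓ, conv6 hℓ]

end Discharge

end Literature.Analysis.FluidPDE.Torus
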